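import Summits.AtomisticToContinuum.FouriersLaw.Theses.HoelderEscapeProfile
import Summits.AtomisticToContinuum.FouriersLaw.Theorems.CornerNoDip.Negative.FalseWithoutDynamics
import Summits.AtomisticToContinuum.FouriersLaw.Theorems.LocalEnergyHalfHoelder.Negative.FrozenFlowExcluded
import Summits.AtomisticToContinuum.FouriersLaw.Theorems.CornerNoDip.Negative.ColdHalo

/-!
# Disproof of `CornerNoDip` (K2, crux stmt-AtomisticToContinuum-16009, route HoelderEscapeProfile) — findings

Standing disprover's work file (refuter cdisprove seat, cycle 1, 2026-08-17).  Prose lives in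
docstrings; everything named `theorem` below is kernel-checked (no `sorry`).  LANDED this cycle under
`Theorems/CornerNoDip/Negative/`: `ColdHaloTriangle.lean` (p159551), `ColdHaloProfile.lean` (p159907),
`ColdHalo.lean` (p160228, theorem `ColdHalo.cornerNoDip_not_from_route_shell`) — importable by
ideators / planners / the lead.

## 0. The crux as typed (probe `W.lean`, rc 0 one sorry)
`∀ (ω₂ lam β > 0) γ (T > 0) μ [DLR Gibbs for pinnedChain, shift-invariant, momentum-reversal
invariant] D : InfiniteChainDynamics [PreservesMeasure μ, shift-commuting a.e.],
G x t := ∫ j₀ σ · jₓ(φ_t σ) dμ, Gh ν k := ∫₀^∞ e^{-νt} Σ'_x cos(kx) G x t dt,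
[∀ t, HasAbsConvergentCorrelation] → [∀ ν>0 ∀ k, Abel integrand integrable] →
∀ a>0 ∀ ε>0 ∃ ν₀>0 ∀ ν ∈ (0,ν₀] ∀ |k| ≤ a√ν, Gh ν k ≤ Gh ν 0 + ε`.
Read back symbol by symbol: coercion `(x:ℝ)` inside `cos (k * x)` only; no ℕ-subtraction, no
division (the `/ν` lives in FibreCalculus, `ν > 0`); `tsum`/Bochner junk is neutralised by the two
guards; quantifier order `∀ a ε ∃ ν₀ ∀ ν k` = "limsup_{ν↓0} sup_{|k|≤a√ν}(𝒢_ν(k) − 𝒢_ν(0)) ≤ 0 for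
every a", which (given `0 ≤ f̂_ν ≤ χ(k)`, i.e. `0 ≤ 𝒢_ν(k) ≤ νχ(k)/(2−2cos k)`) is EQUIVALENT to
the unwindowed "sup over all k" form — the parabolic window is bookkeeping, not content.
`closes` uses it once, with `a = 8πC′/χ`, `ε = χ³/(512π²C′²)`.

## A. Load-bearing analysis
* A1 (frame).  NO JUNK MODEL: an unconditional `¬ CornerNoDip` needs a DLR Gibbs state `μ_T` of
  the quartic pinned chain AND an `InfiniteChainDynamics` preserving it — i.e. an inhabitant of
  the open crux `SymmetricSetup` (stmt-11036).  The only cheap dynamics (frozen / rest flows) are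
  excluded: `cornerNoDip_frame_noFrozenFlow` below (re-export of the landed
  `FrozenFlowExcluded.no_frozen_dynamics`: `PreservesMeasure` makes the carrier conull, `isSolution`
  forces `p₀ = 0` on a frozen orbit, and `{p₀ = 0}` is null for every chain Gibbs state).  Dirac
  masses at equilibria are not Gibbs; staggered/uniform breathing modes carry zero bond current.
  So until stmt-11036 is inhabited the crux is refutation-proof AS TYPED; negative knowledge can
  only be landed at the level of its analytic shell.
* A2 (analytic guards alone).  `cornerNoDip_false_without_dynamics` (landed,
  Negative/FalseWithoutDynamics.lean; re-exported below): with `G` arbitrary the conclusion fails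
  for the frozen kernel `G x t = −[x=1]` (a negative Drude atom at separation 1).  Killed by any
  Abel decay `νG_ν(x) → 0`.
* A3 (ALL of the route's structure — NEW, this cycle, LANDED p160228).
  `ColdHalo.cornerNoDip_not_from_route_shell` (`Theorems/CornerNoDip/Negative/ColdHalo.lean`,
  helpers `ColdHaloTriangle.lean` p159551, `ColdHaloProfile.lean` p159907): the conclusion fails for a COLD-HALO Abel heating
  profile that satisfies every frame-free clause of `FibreCalculus` (summabilities, χ > 0,
  conservation Σ S̄_ν = χ, Bochner f̂_ν ≥ 0, Parseval, the k-space conservation law, Helfand–Abel),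
  evenness, `Ψ ≥ 0`, the conclusion of K1 (`Ψ(ν) ≤ (5/8)√ν`), of AbelSpreadCeiling
  (`Σx²S̄_ν ≤ 1/ν`), AbelRegularity in the strong form `A(ν) → 1/12 > 0`, and `𝒢_ν(k) ≥ 0 ∀ k`.
  Witness: `S̄_ν = prof ⌈1/√ν⌉₊`, `prof n = (5/8)F_n + (1/4)F_n(·∓2n) − (1/16)F_n(·∓4n)`, `F_n` the
  Fejér triangle; `f̂_ν(k) = Fejér_n(k)(1 − sin⁴(nk)) ∈ [0,1]`; at `ν = 1/n²`, `k* = π/(2n)`: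
  `f̂_ν(k*) = 0`, `𝒢_ν(k*) ≥ 4/π² > 0.4 > 1/12 + 1/4 ≥ 𝒢_ν(0) + 1/4`.  MEANING: a dip at the corner
  is, at leading order, a NEGATIVE FOURTH MOMENT of the Abel heating profile (`f̂_ν(u√ν) =
  1 − bu² − cu⁴ + …` dips below its osculating parabola iff `c > 0` iff `Σx⁴S̄_ν < 0`), which
  conservation + Bochner + second-moment information cannot see.  Any proof of K2 must use a
  property of the true kernel beyond the route's identities: positivity of the Abel heating profile
  at range ≳ 1/√ν (line `heatprofile`, stub_mesoNegativePartNegligible) or a long-range sign of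
  the Abel current kernel (line `birth`).  Conversely K2 is NOT necessary for the route's output:
  the witness has κ₀ = 1/12 > 0 with a dip.  NO LOSSY TRANSFER EITHER: moving the shoulders/lobes
  to `±jn`, `±2jn` (`j ≥ 2`) keeps mass, return value `5/(8n)` and second moment `(n²−1)/6`
  (the halo always has zero second moment) but makes `f̂_ν(π/(jn)) = 0`, so
  `𝒢_ν(π/(jn)) ≥ j²/π²` while `𝒢_ν(0) → 1/12`: the shell does not even give
  `𝒢_ν(0) ≥ c·𝒢_ν(k) − ε` on the window for ANY fixed `c > 0` (not formalised; same proof with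
  `2n ↦ jn`).  A planner wanting a weaker K2′ that still feeds `closes` (any fixed transfer
  constant `c` would do: `liminf A ≥ 2c·c₁ − ε`) gains nothing at the shell level — the content is
  the same positivity input.
* A4 (anharmonicity `0 < lam`, `0 < β`).  NOT load-bearing for K2 (heuristic, not formalisable
  here): at the harmonic member the Gibbs state is Gaussian and `h_x∘φ_t` a PSD quadratic form, so
  `S(x,t) = 2 tr(C½AC½·C½BC½) ≥ 0` (Isserlis) and the exact lattice-Fejér domination
  `𝒢_ν(k) − 𝒢_ν(0) = −ν Σ_x K_k(x)(S̄_ν(x) − S(x,0))`, `K_k ≥ 0`, gives NO DIP although transport is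
  ballistic (`𝒢_ν(0) → ∞`).  K2 alone does not distinguish normal from anomalous conduction; that
  is K1 + ceiling.  (Contrast: K1 and AbelSpreadCeiling are FALSE at lam = β = 0.)
* A5 (momentum reversal, shift-commutation).  Used upstream (S even in t ⇒ ∂ₜŜ(k,0) = 0 in the
  conservation law; `⟨j_x, j_y∘φ_t⟩ = G(y−x,t)`); for K2 in isolation they only enter through the
  identification of `Gh` with the fibred conductivity.  No cheap model separates them.

## B. Tightness / shape of the conclusion
* B1 one-sidedness is essential: the TWO-SIDED form (joint corner continuity on the parabolic ray,
  the planner's stated fallback in KILL CRITERIA) is false already for the diffusive calibration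
  `𝒢_ν(k) = ν/(ν + k²)` (`not_twoSidedCorner_calibration`: `|𝒢_ν(√ν) − 𝒢_ν(0)| = 1/2`), while the
  one-sided form holds there with ε = 0 (`cornerNoDip_calibration`).  Do not "repair" K2 into a
  two-sided statement.
* B2 `ε = 0` (global maximum at k = 0, census S⁺₁) and monotonicity in |k| (S⁺₂): consistent
  with MD (census j024522) and with every reversible linear caricature; tool-less; the cold-halo
  witness says nothing new about them.

## C. Numerics / literature (no new job this cycle; `lit search` DEGRADED 2026-08-17T12:30Z:
## local searchd connection reset, OpenAlex 429, arXiv leg 0 rows — not re-run, census searches stand)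
MD of the census (j024522, N = 1024, 64 replicas, T ∈ {0.3, 1, 3}, ω₂ = lam = β = 1): `𝒢_ν`
maximal at k = 0 for ν ∈ [0.01, 0.2], a ≤ 8; `S̄_ν > 0`, `G_ν > 0` on the whole window.  No printed
negative result (anti-Drude dip of a fibred heat conductivity) for pinned anharmonic chains was
found by the census searches; displaced-Drude-peak phenomenology concerns σ(ω) at k = 0 in
near-localised systems, and on the parabolic scale ν → 0 sub-diffusion makes BOTH sides vanish
(K2 trivially true), super-diffusion is excluded by `A(ν) < ∞` at fixed ν.

## D. Targets (lead's stuck stubs): none served this cycle (payload.targets = []).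

## WHY IT RESISTS (one paragraph for provers)
K2 is a hydrodynamic-REGULARITY statement: "the energy mode k relaxes like a positive heat kernel
on the diffusive scale".  Every scaling scenario (sub-, normal, ballistic) satisfies it; it fails
only for oscillatory / cold-halo scaling functions (negative fourth moment of S̄_ν, e.g.
`φ(u) = sinc²(u/2)(1 − sin⁴u)` or a Lorentzian mixed with a k²-dispersive mode), which no principle
in tree excludes and no simulation exhibits.  A refutation needs SymmetricSetup's objects plus a
cold halo in the true quartic chain; a proof needs a positivity/monotonicity input that the
route's identities provably do not supply (A3).
-/

noncomputable section

namespace Summit.AtomisticToContinuum.FouriersLaw.Cruxes.CornerNoDip.Disproof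

open MeasureTheory Set Filter Topology
open Literature.MathematicalPhysics.KineticTheory.HeatConduction

/-! ## A1 — the frame admits no frozen junk -/

/-- In the frame of `CornerNoDip` (any parameters, any temperature) a frozen flow is impossible:
re-export of `FrozenFlowExcluded.no_frozen_dynamics` at `pinnedChain ω₂ lam β γ`. [folklore] -/
theorem cornerNoDip_frame_noFrozenFlow (ω₂ lam β γ T : ℝ) (μ : Measure ChainConfig)
    (hG : (pinnedChain ω₂ lam β γ).IsChainGibbsMeasure T μ)
    (D : InfiniteChainDynamics (pinnedChain ω₂ lam β γ)) (hP : D.PreservesMeasure μ)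
    (hfrozen : ∀ σ ∈ D.carrier, ∀ t, D.flow t σ = σ) : False :=
  Theorems.LocalEnergyHalfHoelder.Negative.FrozenFlowExcluded.no_frozen_dynamics _ T μ hG D hP hfrozen

/-! ## A2 — analytic guards alone do not give K2 (landed) -/

/-- Re-export of `Theorems.CornerNoDip.Negative.cornerNoDip_false_without_dynamics`. [folklore] -/
theorem cornerNoDip_false_without_dynamics' :
    ¬ (∀ G : ℤ → ℝ → ℝ, ∀ Gh : ℝ → ℝ → ℝ,
        Gh = (fun (ν k : ℝ) => ∫ t in Set.Ioi (0:ℝ),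
          Real.exp (-(ν * t)) * ∑' x : ℤ, Real.cos (k * (x : ℝ)) * G x t) →
        (∀ t : ℝ, Summable fun x : ℤ => |G x t|) →
        (∀ ν : ℝ, 0 < ν → ∀ k : ℝ, IntegrableOn (fun t : ℝ =>
          Real.exp (-(ν * t)) * ∑' x : ℤ, Real.cos (k * (x : ℝ)) * G x t) (Set.Ioi 0)) →
        ∀ a : ℝ, 0 < a → ∀ ε : ℝ, 0 < ε → ∃ ν₀ : ℝ, 0 < ν₀ ∧ ∀ ν : ℝ, 0 < ν → ν ≤ ν₀ →
          ∀ k : ℝ, |k| ≤ a * Real.sqrt ν → Gh ν k ≤ Gh ν 0 + ε) :=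
  Theorems.CornerNoDip.Negative.cornerNoDip_false_without_dynamics

/-! ## A3 — the whole route shell does not give K2 (NEW; proof in proposals ColdHalo*) -/

/-- The ROUTE SHELL of K2: frame-free clauses (4)–(9), (11), (12) of `FibreCalculus` with `fh`,
`χk` bound to the cosine series, evenness, `Ψ ≥ 0`, K1's conclusion, AbelSpreadCeiling's
conclusion, AbelRegularity as `A(ν) → κ₀ > 0`, `𝒢_ν ≥ 0`, implying K2's conclusion. [folklore] -/
def CornerNoDipRouteShell : Prop :=
  ∀ (S0 : ℤ → ℝ) (Sb : ℝ → ℤ → ℝ) (Gh fh : ℝ → ℝ → ℝ) (χk : ℝ → ℝ),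
    fh = (fun (ν k : ℝ) => ∑' x : ℤ, Real.cos (k * (x : ℝ)) * Sb ν x) →
    χk = (fun k : ℝ => ∑' x : ℤ, Real.cos (k * (x : ℝ)) * S0 x) →
    (∀ ν : ℝ, 0 < ν → Summable (fun x : ℤ => (1 + (x : ℝ) ^ 2) * |Sb ν x|)) →
    Summable (fun x : ℤ => (1 + (x : ℝ) ^ 2) * |S0 x|) →
    0 < χk 0 →
    (∀ ν : ℝ, 0 < ν → ∑' x : ℤ, Sb ν x = χk 0) →
    (∀ ν : ℝ, 0 < ν → ∀ k : ℝ, 0 ≤ fh ν k) →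
    (∀ ν : ℝ, 0 < ν → ∫ k in (-Real.pi)..Real.pi, fh ν k = 2 * Real.pi * Sb ν 0) →
    (∀ ν : ℝ, 0 < ν → ∀ k : ℝ, χk k - fh ν k = (2 - 2 * Real.cos k) * Gh ν k / ν) →
    (∀ ν : ℝ, 0 < ν →
      Gh ν 0 = ν / 2 * ((∑' x : ℤ, (x : ℝ) ^ 2 * Sb ν x) - ∑' x : ℤ, (x : ℝ) ^ 2 * S0 x)) →
    (∀ ν : ℝ, 0 < ν → ∀ x : ℤ, Sb ν (-x) = Sb ν x) →
    (∀ x : ℤ, S0 (-x) = S0 x) →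
    (∀ ν : ℝ, 0 < ν → 0 ≤ Sb ν 0) →
    (∃ C ν₀ : ℝ, 0 < ν₀ ∧ ∀ ν : ℝ, 0 < ν → ν ≤ ν₀ → Sb ν 0 ≤ C * Real.sqrt ν) →
    (∃ B ν₁ : ℝ, 0 < ν₁ ∧ ∀ ν : ℝ, 0 < ν → ν ≤ ν₁ →
      ∑' x : ℤ, (x : ℝ) ^ 2 * Sb ν x ≤ B / ν) →
    (∃ κ₀ : ℝ, 0 < κ₀ ∧
      Filter.Tendsto (fun ν : ℝ => Gh ν 0) (nhdsWithin (0:ℝ) (Set.Ioi 0)) (nhds κ₀)) →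
    (∀ ν : ℝ, 0 < ν → ∀ k : ℝ, 0 ≤ Gh ν k) →
    ∀ a : ℝ, 0 < a → ∀ ε : ℝ, 0 < ε → ∃ ν₀ : ℝ, 0 < ν₀ ∧ ∀ ν : ℝ, 0 < ν → ν ≤ ν₀ →
      ∀ k : ℝ, |k| ≤ a * Real.sqrt ν → Gh ν k ≤ Gh ν 0 + ε

/-- **The route shell of K2 is false** (cold-halo witness): the landed
`Theorems.CornerNoDip.Negative.ColdHalo.cornerNoDip_not_from_route_shell` (p160228; ≈ 780 lines
with the helper files, axioms propext/Classical.choice/Quot.sound). [folklore] -/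
theorem not_cornerNoDipRouteShell : ¬ CornerNoDipRouteShell :=
  Theorems.CornerNoDip.Negative.ColdHalo.cornerNoDip_not_from_route_shell

/-! ## B1 — one-sidedness is essential: the diffusive calibration -/

/-- The diffusive calibration `𝒢_ν(k) = ν/(ν + k²)` (`χD = D = 1`) satisfies K2's conclusion
with `ε = 0`: the one-sided form is consistent with (indeed modelled on) hydrodynamics. [folklore] -/
theorem cornerNoDip_calibration (ν : ℝ) (hν : 0 < ν) (k : ℝ) :
    ν / (ν + k ^ 2) ≤ ν / (ν + 0 ^ 2) := by
  apply div_le_div_of_nonneg_left hν.le (by positivity)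
  nlinarith [sq_nonneg k]

/-- **The two-sided corner form is false even for the diffusive calibration**: with
`Gh ν k = ν/(ν + k²)`, `|Gh ν (√ν) − Gh ν 0| = 1/2` at every `ν`, inside the window `a = 1`.
So "joint (Kadanoff–Martin) corner continuity on the parabolic ray" — named in the route's KILL
CRITERIA as the fallback restatement of K2 — is NOT a repair: the limits `k → 0`, `ν → 0` do not
commute on that ray for any conductor. [folklore] -/
theorem not_twoSidedCorner_calibration :
    ¬ (∀ Gh : ℝ → ℝ → ℝ, Gh = (fun ν k : ℝ => ν / (ν + k ^ 2)) →
      ∀ a : ℝ, 0 < a → ∀ ε : ℝ, 0 < ε → ∃ ν₀ : ℝ, 0 < ν₀ ∧ ∀ ν : ℝ, 0 < ν → ν ≤ ν₀ →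
        ∀ k : ℝ, |k| ≤ a * Real.sqrt ν → |Gh ν k - Gh ν 0| ≤ ε) := by
  intro H
  obtain ⟨ν₀, hν₀, h⟩ := H _ rfl 1 one_pos (1 / 4) (by norm_num)
  have hk : |Real.sqrt ν₀| ≤ 1 * Real.sqrt ν₀ := by
    rw [abs_of_nonneg (Real.sqrt_nonneg _), one_mul]
  have h1 := h ν₀ hν₀ le_rfl (Real.sqrt ν₀) hk
  simp only [Real.sq_sqrt hν₀.le] at h1
  have e1 : ν₀ / (ν₀ + ν₀) = 1 / 2 := by field_simp; ring
  have e2 : ν₀ / (ν₀ + (0:ℝ) ^ 2) = 1 := by simp [hν₀.ne']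
  rw [e1, e2] at h1
  norm_num [abs_of_nonpos] at h1

end Summit.AtomisticToContinuum.FouriersLaw.Cruxes.CornerNoDip.Disproof

end
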